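import Literature.MathematicalPhysics.QuantumFieldTheory.Balaban1983to89.FlowStep

/-!
# K1⁷ — NODE O's LETTER LADDER IN THE RUN CURRENCY, I: the generic edges (PS floor ⟹ no-(1+β₀)⁻¹-shrink on a shrunk level; the box floor pays bounded lags)

Cell `pub-ymgap`, WIDTH SEAT `pub-ymgap-dag-n24-w1` (gen 3; director-ym №197 ∕ HUMAN RULING D-0149).  `--kind proof --supports stmt-QuantumFields-20542 --as helper`
(count-neutral).  Key of record: K1⁷ `Summit.QuantumFields.YangMills.Theses.BalabanUVNodes.StabilityBAtRecordR13SepCoPH` (skeleton v6 03f66ac9cc89391f, plan g82).  Sibling module (II,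
the kernel SEPARATIONS of the rungs inside a two-sided box): `…Theorems.BalabanUVNodesK1NodeOLadderRunwiseSeparations`.
[I] = [Balaban1987RG1] CMP **109** (1987): (0.17)–(0.20) pp.255–256, Thm 2 p.259, §1 (1.20)–(1.22) p.264, Thm 3 p.264, (5.10) p.293; [III] = [Balaban1988Convergent] CMP **119**
(1988): (2.6) p.255.

THE RUN CURRENCY.  Every K1-side NODE-O letter now in the tree is a clause about the (0.20)-solutions `gs` of a history-dependent β-family `β : HBeta` that stay in a window
`]0, γ]` up to step `n` — `RGEqH n β gs ∧ Step.InInterval γ n gs` ([I] (0.20) p.256: `1/g_k² = 1/g_{k+1}² + β_k(g_0,…,g_k)`): K1⁷ v6's registered stub 2″ row (iv) and dag-n24-c's 32H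
`hps`∕`hpsF` read the RUN-WISE PARTIAL-SUM FLOOR `−M ≤ ∑_{j∈[k,n)} β_j(g_0,…,g_j)`; dag-n24-c's 36H `hnh`∕`hnhF` reads the RUN-WISE NO-HALVING `g_m ≤ (1+1)·g_{n′}` (`m < n′ ≤ n`) —
the last member of [III] (2.6) `g_m ≤ (1+β₀)·g_n` at the road's `β₀ := 1`; ym-nodeO-ideate P3 g52's evidence n°90 reads the ∃-slack NO-SHRINK `g_m ≤ (1+β₀)·g_{n′}` for SOME `β₀ > 0`
(the weakest floor-side letter `DagBinding.WorldP` can carry: `WorldP.β₀_pos`); above them sit the SIGN `BetaLowerH 0 γ β` (33H) and the positive box floor (29H); K0⁷'s registered stub 3ᴬ′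
supplies a SIGN-FREE two-sided box `BetaLowerH bₗ γ β ∧ BetaUpperH β′ γ β`.  The tree has the edges box-floor ⟹ sign ⟹ PS floor (`K1RunRowsOfBoxAndPartialSums.runwisePS_of_betaLowerH_nonneg`,
32H §0 `psFloor_zero_of_betaLowerH_zero`), the ceiling side `BetaUpperH ⟹ run-wise ceiling` (36H §0 `runwiseCeiling_of_betaUpperH`), and in FLOW currency the exact content of (2.6)'s
last member (`B14FlowStep.flow26d_iff_partialSum ∕ flow26d_of_betaLower_lag`, strat-b14; dag-n24-w1 g0 `K1EndOfNodes13PWSOfPartialSums.flow26_lower_of_rg_partialSumsLower`).  NOT in the tree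
before this file: the RUN-currency edge PS floor ⟹ no-shrink (ym-nodeO-ideate P3 g52 n°89 §1 :151∕:186, HOME memo `ym-nodeO-ideate/memos/lines/OneKeyAfter32H-P3g52.lean`, kernel-checked
there; dag-n24-c (36H LANDED line) «stays P3's to file» — a planner seat files no Theorems; PORTED HERE WITH ATTRIBUTION).

WHAT IS HERE (generic `β : HBeta`; letters UNFOLDED to the VERBATIM shapes of 32H `hps` ∕ 36H `hnh` ∕ K1 v6 row (iv); NO definition): `rgEqH_zero_const` · `inInterval_zero_const` ·
`psFloor_nonneg_of_level_pos` (`0 ≤ M` on any window of positive level) · `psFloor_iff_boundedAddDrawdown` (`1/g_n² ≤ 1/g_k² + M`; P3 :137) ·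
`noShrink_iff_boundedMulDrawdown` (`1/g_{n′}² ≤ (1+β₀)²/g_m²`) · `noShrink_mono_level` · `noShrink_mono_slack` · ★ `noShrink_of_psFloor_of_small` (PS floor `M` on `]0,γ]` ⟹ no-(1+β₀)⁻¹-shrink
on `]0,γ′]`, `γ′ ≤ γ`, `M·γ′² ≤ 1 − (1+β₀)⁻²`; P3 :151) · ★ `exists_noShrink_of_psFloor` (∀ β₀ > 0 ∃ γ′ ∈ ]0,γ]; P3 :186) · ★ `exists_noHalving_of_psFloor` (β₀ := 1 — the conclusion is 36H's
`hnh` letter VERBATIM, so 32H's NODE-O family `hpsF` yields 36H's `hnhF` POINTWISE in the door letters, the level shrink being absorbed by `∃ γ₀`) · `noShrink_of_absBoxFloor_of_lag` (the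
box floor `−β′` ALONE pays no-shrink on pairs of BOUNDED LAG `(n′−m)·β′·γ² ≤ 1 − (1+β₀)⁻²`: NODE O's K1 letter is a statement about LONG in-window runs only; the sibling module shows the box
pays NO floor-side letter uniformly in the lag).

HONEST FRAMING.  Elementary real analysis on the recursion (0.20) in the run currency; HYPOTHESIS SHAPES only — nothing of Bałaban asserted, nothing about `Node00.betaOfRecord₁₃` proved or
refuted (which letter the true β of record satisfies is NODE O's unprinted content, [I] Thm 2 p.259 ∕ T09.F); NO stub closed; K0⁷ ∕ K1⁷ OPEN; N24 COMPOSITE — no discharge, counts unmoved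
(typed 28∕28 · discharged 5∕27); one finite 𝕋⁴ programme at fixed `ε = L^{−K}`, Bałaban AS PRINTED; route R4 closes ONLY the CONDITIONAL finite-𝕋⁴ rung `BalabanLadder.UV` — the Yang–Mills
mass gap (Clay) is NOT proved by any of this; nothing continuum ∕ ℝ⁴ ∕ OS.  Theorems only: no `def`, no `instance`, no `sorry`, standard axioms; imports `Literature…FlowStep` only (Theses-free).
-/

noncomputable section

namespace Summit.QuantumFields.YangMills.Theorems.K1NodeOLadderRunwiseEdges

open Literature.MathematicalPhysics.QuantumFieldTheory.Balaban1983to89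
open FlowStep (HBeta RGEqH prefixOf prefixOf_apply BetaLowerH BetaUpperH Box mem_box inv_sq_telescopeH)

variable {β : HBeta}

/-! ## §1. Edges of the ladder in the run currency (generic `β : HBeta`) -/

/-- A one-point history `(x)` is a (0.20)-run up to step `0` (no equation to check). [cite: Balaban1987RG1, (0.20) p.256 (bookkeeping)] -/
theorem rgEqH_zero_const (β : HBeta) (x : ℝ) : RGEqH 0 β (fun _ => x) :=
  fun k hk => absurd hk (Nat.not_lt_zero k)

/-- … and it stays in `]0, γ]` iff `0 < x ≤ γ`. [cite: Balaban1987RG1, Thm 1 p.259 (bookkeeping)] -/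
theorem inInterval_zero_const {γ x : ℝ} (hx : 0 < x) (hxγ : x ≤ γ) : Step.InInterval γ 0 (fun _ => x) :=
  fun _ _ => ⟨hx, hxγ⟩

/-- **A PS floor on a window of positive level has `0 ≤ M`** (read it on the one-point run `(γ)`, empty sum). [cite: Balaban1987RG1, (0.20) p.256 (elementary)] -/
theorem psFloor_nonneg_of_level_pos {M γ : ℝ} (hγ : 0 < γ)
    (h : ∀ (n : ℕ) (gs : ℕ → ℝ), RGEqH n β gs → Step.InInterval γ n gs → ∀ k, k ≤ n → -M ≤ ∑ j ∈ Finset.Ico k n, β j (prefixOf gs j)) :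
    0 ≤ M := by
  have h0 := h 0 (fun _ => γ) (rgEqH_zero_const β γ) (inInterval_zero_const hγ le_rfl) 0 le_rfl
  simp only [Finset.Ico_self, Finset.sum_empty] at h0
  linarith

/-- **PS FLOOR ⟺ BOUNDED ADDITIVE DRAWDOWN OF `1/g²`** along in-window (0.20)-runs: `1/g_n² ≤ 1/g_k² + M` (telescoping `FlowStep.inv_sq_telescopeH`; P3 n°89 :137, ported).
[cite: Balaban1987RG1, (0.20) p.256 (elementary)] -/
theorem psFloor_iff_boundedAddDrawdown {M γ : ℝ} :
    (∀ (n : ℕ) (gs : ℕ → ℝ), RGEqH n β gs → Step.InInterval γ n gs → ∀ k, k ≤ n → -M ≤ ∑ j ∈ Finset.Ico k n, β j (prefixOf gs j)) ↔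
      ∀ (n : ℕ) (gs : ℕ → ℝ), RGEqH n β gs → Step.InInterval γ n gs → ∀ k, k ≤ n → 1 / (gs n) ^ 2 ≤ 1 / (gs k) ^ 2 + M := by
  refine ⟨fun h n gs hrg hI k hk => ?_, fun h n gs hrg hI k hk => ?_⟩
  · have htel := inv_sq_telescopeH hrg hk le_rfl
    have := h n gs hrg hI k hk
    linarith
  · have htel := inv_sq_telescopeH hrg hk le_rfl
    have := h n gs hrg hI k hk
    linarith

/-- **NO-(1+β₀)⁻¹-SHRINK ⟺ BOUNDED MULTIPLICATIVE DRAWDOWN OF `1/g²`** along in-window (0.20)-runs: `1/g_{n′}² ≤ (1+β₀)²/g_m²` for `m < n′ ≤ n` (for `1 + β₀ ≥ 0`).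
[cite: Balaban1988Convergent, (2.6) p.255; Balaban1987RG1, (0.20) p.256 (elementary)] -/
theorem noShrink_iff_boundedMulDrawdown {β₀ γ : ℝ} (hβ₀ : 0 ≤ 1 + β₀) :
    (∀ (n : ℕ) (gs : ℕ → ℝ), RGEqH n β gs → Step.InInterval γ n gs → ∀ m n', m < n' → n' ≤ n → gs m ≤ (1 + β₀) * gs n') ↔
      ∀ (n : ℕ) (gs : ℕ → ℝ), RGEqH n β gs → Step.InInterval γ n gs → ∀ m n', m < n' → n' ≤ n → 1 / (gs n') ^ 2 ≤ (1 + β₀) ^ 2 / (gs m) ^ 2 := by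
  refine ⟨fun h n gs hrg hI m n' hmn hn' => ?_, fun h n gs hrg hI m n' hmn hn' => ?_⟩
  · have hm : 0 < gs m := (hI m (hmn.le.trans hn')).1
    have hn : 0 < gs n' := (hI n' hn').1
    have hsq : (gs m) ^ 2 ≤ ((1 + β₀) * gs n') ^ 2 := pow_le_pow_left₀ hm.le (h n gs hrg hI m n' hmn hn') 2
    rw [mul_pow] at hsq
    rw [div_le_div_iff₀ (by positivity) (by positivity), one_mul]
    exact hsq
  · have hm : 0 < gs m := (hI m (hmn.le.trans hn')).1
    have hn : 0 < gs n' := (hI n' hn').1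
    have h1 := h n gs hrg hI m n' hmn hn'
    rw [div_le_div_iff₀ (by positivity) (by positivity), one_mul] at h1
    have hsq : (gs m) ^ 2 ≤ ((1 + β₀) * gs n') ^ 2 := by rw [mul_pow]; exact h1
    exact (pow_le_pow_iff_left₀ hm.le (mul_nonneg hβ₀ hn.le) two_ne_zero).1 hsq

/-- No-shrink on `]0, γ]` restricts to every lower level `γ′ ≤ γ`. [cite: Balaban1988Convergent, (2.6) p.255 (bookkeeping)] -/
theorem noShrink_mono_level {β₀ γ γ' : ℝ} (hle : γ' ≤ γ)
    (h : ∀ (n : ℕ) (gs : ℕ → ℝ), RGEqH n β gs → Step.InInterval γ n gs → ∀ m n', m < n' → n' ≤ n → gs m ≤ (1 + β₀) * gs n') :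
    ∀ (n : ℕ) (gs : ℕ → ℝ), RGEqH n β gs → Step.InInterval γ' n gs → ∀ m n', m < n' → n' ≤ n → gs m ≤ (1 + β₀) * gs n' :=
  fun n gs hrg hI m n' hmn hn' => h n gs hrg (fun i hi => ⟨(hI i hi).1, (hI i hi).2.trans hle⟩) m n' hmn hn'

/-- No-shrink with slack `β₀` gives no-shrink with every larger slack `β₁ ≥ β₀` (couplings are positive in the window). [cite: Balaban1988Convergent, (2.6) p.255 (bookkeeping)] -/
theorem noShrink_mono_slack {β₀ β₁ γ : ℝ} (hle : β₀ ≤ β₁)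
    (h : ∀ (n : ℕ) (gs : ℕ → ℝ), RGEqH n β gs → Step.InInterval γ n gs → ∀ m n', m < n' → n' ≤ n → gs m ≤ (1 + β₀) * gs n') :
    ∀ (n : ℕ) (gs : ℕ → ℝ), RGEqH n β gs → Step.InInterval γ n gs → ∀ m n', m < n' → n' ≤ n → gs m ≤ (1 + β₁) * gs n' :=
  fun n gs hrg hI m n' hmn hn' =>
    (h n gs hrg hI m n' hmn hn').trans (mul_le_mul_of_nonneg_right (by linarith) (hI n' hn').1.le)

/-- **★ LADDER EDGE: PS FLOOR ⟹ NO-(1+β₀)⁻¹-SHRINK ON A SMALL WINDOW** `M·γ′² ≤ 1 − (1+β₀)⁻²`, `γ′ ≤ γ`: from `1/g_m² = 1/g_{n′}² + ∑_{[m,n′)} β ≥ 1/g_{n′}² − M` and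
`M ≤ (1 − (1+β₀)⁻²)/g_{n′}²` (as `g_{n′} ≤ γ′`) one gets `1/g_m² ≥ (1+β₀)⁻²/g_{n′}²`, i.e. `g_m ≤ (1+β₀)·g_{n′}`.  ym-nodeO-ideate P3 g52 n°89 `runwiseMulFloor_of_runwisePSFloor` (:151), PORTED WITH
ATTRIBUTION, letters unfolded (the computation is dag-n24-w1 g0 p588006's `flow26_lower_of_rg_partialSumsLower` in run currency).
[cite: Balaban1988Convergent, (2.6) p.255; Balaban1987RG1, (0.20) p.256 (elementary)] -/
theorem noShrink_of_psFloor_of_small {M γ γ' β₀ : ℝ} (hβ₀ : 0 < β₀)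
    (h : ∀ (n : ℕ) (gs : ℕ → ℝ), RGEqH n β gs → Step.InInterval γ n gs → ∀ k, k ≤ n → -M ≤ ∑ j ∈ Finset.Ico k n, β j (prefixOf gs j))
    (hγ' : γ' ≤ γ) (hsmall : M * γ' ^ 2 ≤ 1 - ((1 + β₀) ^ 2)⁻¹) :
    ∀ (n : ℕ) (gs : ℕ → ℝ), RGEqH n β gs → Step.InInterval γ' n gs → ∀ m n', m < n' → n' ≤ n → gs m ≤ (1 + β₀) * gs n' := by
  intro n gs hrg hI m n' hmn hn'
  have hI' : Step.InInterval γ n gs := fun k hk => ⟨(hI k hk).1, (hI k hk).2.trans hγ'⟩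
  have hm : 0 < gs m := (hI m (hmn.le.trans hn')).1
  have hn : 0 < gs n' := (hI n' hn').1
  have hnγ : gs n' ≤ γ' := (hI n' hn').2
  have hM : 0 ≤ M := by
    have h0 := h n gs hrg hI' n le_rfl
    simp only [Finset.Ico_self, Finset.sum_empty] at h0
    linarith
  have htel : 1 / (gs m) ^ 2 = 1 / (gs n') ^ 2 + ∑ i ∈ Finset.Ico m n', β i (prefixOf gs i) :=
    inv_sq_telescopeH hrg hmn.le hn'
  have hS : -M ≤ ∑ i ∈ Finset.Ico m n', β i (prefixOf gs i) :=
    h n' gs (fun k hk => hrg k (lt_of_lt_of_le hk hn')) (fun k hk => hI' k (hk.trans hn')) m hmn.le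
  have hMg : M * (gs n') ^ 2 ≤ 1 - ((1 + β₀) ^ 2)⁻¹ :=
    (mul_le_mul_of_nonneg_left (pow_le_pow_left₀ hn.le hnγ 2) hM).trans hsmall
  have hn2 : 0 < (gs n') ^ 2 := by positivity
  have key : 1 / ((1 + β₀) * gs n') ^ 2 ≤ 1 / (gs m) ^ 2 := by
    have hMle : M ≤ (1 - ((1 + β₀) ^ 2)⁻¹) / (gs n') ^ 2 := by
      rw [le_div_iff₀ hn2]; exact hMg
    have e : 1 / ((1 + β₀) * gs n') ^ 2 = 1 / (gs n') ^ 2 - (1 - ((1 + β₀) ^ 2)⁻¹) / (gs n') ^ 2 := by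
      field_simp
      ring
    rw [e, htel]
    linarith
  have hsq : (gs m) ^ 2 ≤ ((1 + β₀) * gs n') ^ 2 := by
    have hA : 0 < ((1 + β₀) * gs n') ^ 2 := by positivity
    exact (one_div_le_one_div hA (by positivity)).1 key
  exact (pow_le_pow_iff_left₀ hm.le (by positivity) two_ne_zero).1 hsq

/-- **★ … the `∃ γ′`-form: a PS floor on `]0, γ]` gives no-(1+β₀)⁻¹-shrink on SOME `]0, γ′]`, `0 < γ′ ≤ γ`, for EVERY slack `β₀ > 0`** (`γ′ := min γ √((1 − (1+β₀)⁻²)/(M+1))`).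
ym-nodeO-ideate P3 g52 n°89 `exists_runwiseMulFloor_of_runwisePSFloor` (:186), PORTED WITH ATTRIBUTION. [cite: Balaban1988Convergent, (2.6) p.255; Balaban1987RG1, (0.20) p.256 (elementary)] -/
theorem exists_noShrink_of_psFloor {M γ β₀ : ℝ} (hβ₀ : 0 < β₀) (hγ : 0 < γ)
    (h : ∀ (n : ℕ) (gs : ℕ → ℝ), RGEqH n β gs → Step.InInterval γ n gs → ∀ k, k ≤ n → -M ≤ ∑ j ∈ Finset.Ico k n, β j (prefixOf gs j)) :
    ∃ γ' : ℝ, 0 < γ' ∧ γ' ≤ γ ∧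
      ∀ (n : ℕ) (gs : ℕ → ℝ), RGEqH n β gs → Step.InInterval γ' n gs → ∀ m n', m < n' → n' ≤ n → gs m ≤ (1 + β₀) * gs n' := by
  have hM : 0 ≤ M := psFloor_nonneg_of_level_pos hγ h
  set c₀ : ℝ := 1 - ((1 + β₀) ^ 2)⁻¹ with hc₀_def
  have hc₀ : 0 < c₀ := by
    have h1 : 1 < (1 + β₀) ^ 2 := by nlinarith
    have h2 : ((1 + β₀) ^ 2)⁻¹ < 1 := inv_lt_one_of_one_lt₀ h1
    rw [hc₀_def]; linarith
  set γM : ℝ := Real.sqrt (c₀ / (M + 1)) with hγM_def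
  have hγM : 0 < γM := Real.sqrt_pos.mpr (by positivity)
  have hsmall : M * (min γ γM) ^ 2 ≤ c₀ := by
    have h1 : (min γ γM) ^ 2 ≤ γM ^ 2 := pow_le_pow_left₀ (lt_min hγ hγM).le (min_le_right _ _) 2
    have h2 : γM ^ 2 = c₀ / (M + 1) := by rw [hγM_def, Real.sq_sqrt (by positivity)]
    have h3 : M * (c₀ / (M + 1)) ≤ c₀ := by
      rw [mul_div_assoc', div_le_iff₀ (by positivity)]
      nlinarith [hc₀, hM]
    calc M * (min γ γM) ^ 2 ≤ M * γM ^ 2 := mul_le_mul_of_nonneg_left h1 hM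
      _ = M * (c₀ / (M + 1)) := by rw [h2]
      _ ≤ c₀ := h3
  exact ⟨min γ γM, lt_min hγ hγM, min_le_left _ _, noShrink_of_psFloor_of_small hβ₀ h (min_le_left _ _) hsmall⟩

/-- **★ LADDER EDGE IN THE TREE's LETTERS: PS FLOOR ⟹ NO-HALVING on some lower level** — the slack `β₀ := 1`; the conclusion is dag-n24-c 36H's `hnh` letter VERBATIM (`gs m ≤ (1 + 1) * gs n'`),
so 32H's NODE-O family `hpsF` (∃ level, PS floor) yields 36H's `hnhF` (∃ level, no-halving) POINTWISE in the door letters. [cite: Balaban1988Convergent, (2.6) p.255; Balaban1987RG1, (0.20) p.256 (elementary)] -/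
theorem exists_noHalving_of_psFloor {M γ : ℝ} (hγ : 0 < γ)
    (h : ∀ (n : ℕ) (gs : ℕ → ℝ), RGEqH n β gs → Step.InInterval γ n gs → ∀ k, k ≤ n → -M ≤ ∑ j ∈ Finset.Ico k n, β j (prefixOf gs j)) :
    ∃ γ' : ℝ, 0 < γ' ∧ γ' ≤ γ ∧
      ∀ (n : ℕ) (gs : ℕ → ℝ), RGEqH n β gs → Step.InInterval γ' n gs → ∀ m n', m < n' → n' ≤ n → gs m ≤ (1 + 1) * gs n' :=
  exists_noShrink_of_psFloor one_pos hγ h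

/-- **THE BOX FLOOR ALONE PAYS NO-SHRINK ON PAIRS OF BOUNDED LAG**: from the trajectory-wise floor `−β′ ≤ β_j(g_0,…,g_j)` along a run in `]0, γ]`, `1/g_{n′}² ≤ 1/g_m² + β′·(n′−m)`, hence
`g_m ≤ (1+β₀)·g_{n′}` whenever `(n′−m)·β′·γ² ≤ 1 − (1+β₀)⁻²` (strat-b14's `B14FlowStep.flow26d_of_betaLower_lag`, run currency).  So NODE O's K1 letter is a statement about LONG in-window runs only.
[cite: Balaban1988Convergent, (2.6) p.255; Balaban1987RG1, (0.20) p.256, §1 p.264 (elementary)] -/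
theorem noShrink_of_absBoxFloor_of_lag {β' γ β₀ : ℝ} (hβ' : 0 ≤ β') (hβ₀ : 0 < β₀) (hlo : BetaLowerH (-β') γ β)
    {n : ℕ} {gs : ℕ → ℝ} (hrg : RGEqH n β gs) (hI : Step.InInterval γ n gs) {m n' : ℕ} (hmn : m < n') (hn' : n' ≤ n)
    (hlag : ((n' : ℝ) - m) * β' * γ ^ 2 ≤ 1 - ((1 + β₀) ^ 2)⁻¹) : gs m ≤ (1 + β₀) * gs n' := by
  have hm : 0 < gs m := (hI m (hmn.le.trans hn')).1
  have hn : 0 < gs n' := (hI n' hn').1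
  have hnγ : gs n' ≤ γ := (hI n' hn').2
  have htel : 1 / (gs m) ^ 2 = 1 / (gs n') ^ 2 + ∑ i ∈ Finset.Ico m n', β i (prefixOf gs i) :=
    inv_sq_telescopeH hrg hmn.le hn'
  have hS : -(((n' : ℝ) - m) * β') ≤ ∑ i ∈ Finset.Ico m n', β i (prefixOf gs i) := by
    have hterm : ∀ i ∈ Finset.Ico m n', -β' ≤ β i (prefixOf gs i) := fun i hi =>
      hlo i _ (mem_box.mpr fun j => ⟨(hI j ((Nat.le_of_lt_succ j.isLt).trans ((Finset.mem_Ico.mp hi).2.le.trans hn'))).1,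
        (hI j ((Nat.le_of_lt_succ j.isLt).trans ((Finset.mem_Ico.mp hi).2.le.trans hn'))).2⟩)
    have := Finset.sum_le_sum hterm
    rw [Finset.sum_const, Nat.card_Ico, nsmul_eq_mul, Nat.cast_sub hmn.le] at this
    linarith
  have hlag' : ((n' : ℝ) - m) * β' * (gs n') ^ 2 ≤ 1 - ((1 + β₀) ^ 2)⁻¹ := by
    have hd : 0 ≤ ((n' : ℝ) - m) * β' := mul_nonneg (sub_nonneg.mpr (by exact_mod_cast hmn.le)) hβ'
    exact (mul_le_mul_of_nonneg_left (pow_le_pow_left₀ hn.le hnγ 2) hd).trans hlag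
  have hn2 : 0 < (gs n') ^ 2 := by positivity
  have key : 1 / ((1 + β₀) * gs n') ^ 2 ≤ 1 / (gs m) ^ 2 := by
    have hMle : ((n' : ℝ) - m) * β' ≤ (1 - ((1 + β₀) ^ 2)⁻¹) / (gs n') ^ 2 := by
      rw [le_div_iff₀ hn2]; exact hlag'
    have e : 1 / ((1 + β₀) * gs n') ^ 2 = 1 / (gs n') ^ 2 - (1 - ((1 + β₀) ^ 2)⁻¹) / (gs n') ^ 2 := by
      field_simp
      ring
    rw [e, htel]
    linarith
  have hsq : (gs m) ^ 2 ≤ ((1 + β₀) * gs n') ^ 2 := by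
    have hA : 0 < ((1 + β₀) * gs n') ^ 2 := by positivity
    exact (one_div_le_one_div hA (by positivity)).1 key
  exact (pow_le_pow_iff_left₀ hm.le (by positivity) two_ne_zero).1 hsq

end Summit.QuantumFields.YangMills.Theorems.K1NodeOLadderRunwiseEdges

end
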